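/-
Copyright (c) 2026. All rights reserved.
Released under Apache 2.0 license as described in the file LICENSE.
Authors: abc-iut cell, statement-typer seat abc-iut-L4-t3 (wave 1).
-/
import Mathlib.Analysis.SpecialFunctions.Log.Basic
import Literature.NumberTheory.GaloisRepresentations.UniformizerModulus
import HarnessLib

/-!
# [AbsTopIII] Proposition 5.7 (i): volumes and log-volumes on a nonarchimedean local field

S. Mochizuki, *Topics in absolute anabelian geometry III: global reconstruction algorithms*,
J. Math. Sci. Univ. Tokyo 22 (2015) 939–1156 [MochizukiAbsTopIII2015]; locators are pages of the
author's manuscript (lit key `paper:url-5493eb38cbb7`, 164 pp), read on the page (p. 137 l. 28 –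
p. 138 l. 17 for the statement of (i), p. 139 ll. 1–10 for its proof).

Proposition 5.7 is introduced by the text as "elementary and well-known" (p. 137); part (i) concerns a
mixed-characteristic nonarchimedean local field `k`:

* (a) on the set `M(k)` of compact open subsets of `k` there is a UNIQUE map `μ_k : M(k) → ℝ_{>0}`
  that is additive on disjoint unions, `⊞`-translation invariant and normalised by `μ_k(𝒪_k) = 1`
  (the *volume*); `μ_k^log := log ∘ μ_k` is the *log-volume*; if the residue field has `p^f` elements
  then `μ_k^log(𝔪_k^n) = -f·n·log p`;
* (b) for `x ∈ k^×`, `μ̇_k(x) := μ_k(x·𝒪_k)` and `μ_k^log(x·A) = μ_k^log(A) + μ̇_k^log(x)`, in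
  particular `μ_k^log(x·A) = μ_k^log(A)` for `x ∈ 𝒪_k^×`;
* (c) *log-compatibility*: if `A ⊆ 𝒪_k^×` is (compact) open and the `p`-adic logarithm `log_k`
  is injective on `A`, then `μ_k^log(A) = μ_k^log(log_k(A))`.

## What is here (real definitions over Mathlib; proofs where the text says "Haar measure")

We work, as in `Literature/NumberTheory/GaloisRepresentations/UniformizerModulus.lean`, with a
nontrivially normed ULTRAMETRIC field `K` that is a proper metric space (every mixed-characteristic
local field with its normalised absolute value is such; so are `ℚ_[p]` and `v.adicCompletion`), and
with `𝒪 = closedBall 0 1`.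

* `compactOpens K` = `M(k)` (we require NONEMPTY: `μ_k` is valued in `ℝ_{>0}` and additive, so the text's
  `M(k)` cannot contain `∅` — recorded for the referee);
* `localHaar K` = the additive Haar measure normalised on the positive compact `𝒪`, `localVolume K A`
  = its value on `A` as a real number (= `μ_k(A)`), `localLogVolume K A = log μ_k(A)`,
  `unitVolume K x = μ̇_k(x) = μ_k(x·𝒪)`, `unitLogVolume`;
* PROVED: existence half of (a) — positivity on `M(k)`, additivity, translation invariance,
  normalisation (`localVolume_closedBall_one`), the formula `μ_k(ϖ^n 𝒪) = q^{-n}` with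
  `q = [𝒪 : ϖ𝒪]` (`localVolume_piBall_pow`; with `q = p^f` this is the printed `-f·n·log p`,
  `localLogVolume_piBall_pow_eq`), and all of (b) (`localLogVolume_units_smul`,
  `localLogVolume_units_smul_of_norm_eq_one`), via Weil's module = Mathlib's `distribHaarChar`;
* NAMED FACTS (stated, not proved here): the uniqueness half of (a) (`LocalVolumeUnique`) and the
  log-compatibility (c) (`LogVolumeCompatible`, a predicate on the logarithm map, since the `p`-adic
  logarithm of a general local field is not in Mathlib at the pin; the cell's seat abc-iut-S1 supplies it
  — TODO-merge:abc-iut-S1). Both follow from the decomposition of a compact open set into finitely many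
  cosets of `𝔪_k^n` (the text's proof, p. 139); left to a prover seat.

NOT here: part (ii) (complex archimedean fields: radial/angular volumes) — sibling file
`LocalVolumesArchimedean.lean`; Proposition 5.8 (mono-analytic reconstruction of these volumes from
the absolute Galois group) — sibling file. This file takes no position on any disputed claim; Prop. 5.7
is classical measure theory.
-/

set_option autoImplicit false

noncomputable section

open MeasureTheory MeasureTheory.Measure Set Metric
open scoped Pointwise NNReal ENNReal

namespace Literature.AnabelianGeometry.AbsoluteAnabelian

open Literature.NumberTheory.GaloisRepresentations.Ultrametric

variable (K : Type*) [NontriviallyNormedField K] [IsUltrametricDist K] [ProperSpace K]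

/-! ## `M(k)` and the normalised Haar measure -/

/-- `M(k)`: the set of NONEMPTY compact open subsets of the local field `k`
(the text writes "compact open subsets"; nonemptiness is forced by `μ_k(A) ∈ ℝ_{>0}` and additivity).
[cite: MochizukiAbsTopIII2015, Prop 5.7 (i) p. 137] -/
def compactOpens : Set (Set K) := {A | A.Nonempty ∧ IsCompact A ∧ IsOpen A}

variable {K} in
omit [IsUltrametricDist K] [ProperSpace K] in
/-- membership in `M(k)` unfolded. [cite: MochizukiAbsTopIII2015, Prop 5.7 (i) p. 137] -/
theorem mem_compactOpens {A : Set K} :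
    A ∈ compactOpens K ↔ A.Nonempty ∧ IsCompact A ∧ IsOpen A := Iff.rfl

/-- `𝒪_k = closedBall 0 1` as a positive compact subset of `k` (compact because `k` is proper, with
nonempty interior because closed balls of positive radius are open in an ultrametric field); the
normalising set of `μ_k`. [cite: MochizukiAbsTopIII2015, Prop 5.7 (i)(a)(3) p. 137] -/
def integersPositiveCompacts : TopologicalSpace.PositiveCompacts K where
  carrier := closedBall (0 : K) 1
  isCompact' := isCompact_closedBall (0 : K) 1
  interior_nonempty' := by
    rw [(isOpen_closedBall_zero (K := K) one_pos).interior_eq]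
    exact ⟨0, mem_closedBall_self zero_le_one⟩

/-- the carrier of `integersPositiveCompacts K` is `𝒪_k = closedBall 0 1` (plumbing for the
normalisation `μ_k(𝒪_k) = 1`). [cite: MochizukiAbsTopIII2015, Prop 5.7 (i)(a)(3) p. 137] -/
@[simp] theorem coe_integersPositiveCompacts :
    ((integersPositiveCompacts K : TopologicalSpace.PositiveCompacts K) : Set K) = closedBall (0 : K) 1 :=
  rfl

variable [MeasurableSpace K] [BorelSpace K]

/-- `μ_k` as a measure: the additive Haar measure of `k` normalised by `μ_k(𝒪_k) = 1`.
[cite: MochizukiAbsTopIII2015, Prop 5.7 (i)(a) p. 137] -/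
def localHaar : Measure K := addHaarMeasure (integersPositiveCompacts K)

/-- `μ_k` is an additive Haar measure (in particular additive and translation invariant).
[cite: MochizukiAbsTopIII2015, Prop 5.7 (i)(a) p. 137] -/
instance isAddHaarMeasure_localHaar : IsAddHaarMeasure (localHaar K) := by
  unfold localHaar; infer_instance

/-- normalisation (3): `μ_k(𝒪_k) = 1`. [cite: MochizukiAbsTopIII2015, Prop 5.7 (i)(a)(3) p. 137] -/
theorem localHaar_closedBall_one : localHaar K (closedBall (0 : K) 1) = 1 := by
  rw [localHaar, ← coe_integersPositiveCompacts, addHaarMeasure_self]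

/-! ## The volume `μ_k : M(k) → ℝ_{>0}` and the log-volume -/

/-- the *volume* `μ_k(A)` of a subset `A ⊆ k`, as a real number (the value of the normalised Haar
measure; meaningful on `M(k)`, where it is positive and finite; junk value `0` on sets of infinite
measure). [cite: MochizukiAbsTopIII2015, Prop 5.7 (i)(a) p. 137] -/
def localVolume (A : Set K) : ℝ := (localHaar K A).toReal

/-- the *log-volume* `μ_k^log(A) := log μ_k(A)` (natural logarithm).
[cite: MochizukiAbsTopIII2015, Prop 5.7 (i)(a) p. 137] -/
def localLogVolume (A : Set K) : ℝ := Real.log (localVolume K A)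

/-- `μ̇_k(x) := μ_k(x · 𝒪_k)` for `x ∈ k^×`. [cite: MochizukiAbsTopIII2015, Prop 5.7 (i)(b) p. 138] -/
def unitVolume (x : Kˣ) : ℝ := localVolume K (x • closedBall (0 : K) 1)

/-- `μ̇_k^log(x) := log μ̇_k(x)` for `x ∈ k^×`. [cite: MochizukiAbsTopIII2015, Prop 5.7 (i)(b) p. 138] -/
def unitLogVolume (x : Kˣ) : ℝ := Real.log (unitVolume K x)

variable {K}

/-- on `M(k)` the measure `μ_k` is finite. [cite: MochizukiAbsTopIII2015, Prop 5.7 (i)(a) p. 137] -/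
theorem localHaar_lt_top_of_mem {A : Set K} (hA : A ∈ compactOpens K) : localHaar K A < ∞ :=
  hA.2.1.measure_lt_top

/-- on `M(k)` the measure `μ_k` is positive. [cite: MochizukiAbsTopIII2015, Prop 5.7 (i)(a) p. 137] -/
theorem localHaar_pos_of_mem {A : Set K} (hA : A ∈ compactOpens K) : 0 < localHaar K A :=
  hA.2.2.measure_pos (localHaar K) hA.1

/-- `μ_k` takes values in `ℝ_{>0}` on `M(k)`. [cite: MochizukiAbsTopIII2015, Prop 5.7 (i)(a) p. 137] -/
theorem localVolume_pos {A : Set K} (hA : A ∈ compactOpens K) : 0 < localVolume K A :=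
  ENNReal.toReal_pos (localHaar_pos_of_mem hA).ne' (localHaar_lt_top_of_mem hA).ne

/-- normalisation (3) for the volume: `μ_k(𝒪_k) = 1`.
[cite: MochizukiAbsTopIII2015, Prop 5.7 (i)(a)(3) p. 137] -/
theorem localVolume_closedBall_one : localVolume K (closedBall (0 : K) 1) = 1 := by
  simp [localVolume, localHaar_closedBall_one]

/-- additivity (1): `μ_k(A ∪ B) = μ_k(A) + μ_k(B)` for disjoint `A, B ∈ M(k)`.
[cite: MochizukiAbsTopIII2015, Prop 5.7 (i)(a)(1) p. 137] -/
theorem localVolume_union {A B : Set K} (hA : A ∈ compactOpens K) (hB : B ∈ compactOpens K)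
    (hAB : Disjoint A B) : localVolume K (A ∪ B) = localVolume K A + localVolume K B := by
  rw [localVolume, measure_union hAB hB.2.2.measurableSet,
    ENNReal.toReal_add (localHaar_lt_top_of_mem hA).ne (localHaar_lt_top_of_mem hB).ne]
  rfl

/-- `⊞`-translation invariance (2): `μ_k(A + x) = μ_k(A)` for every subset `A` and `x ∈ k`
(we write the translate as `x +ᵥ A`; `k` is commutative). [cite: MochizukiAbsTopIII2015, Prop 5.7 (i)(a)(2) p. 137] -/
theorem localVolume_vadd (x : K) (A : Set K) : localVolume K (x +ᵥ A) = localVolume K A := by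
  rw [localVolume, localVolume, measure_vadd]

omit [IsUltrametricDist K] [ProperSpace K] [MeasurableSpace K] [BorelSpace K] in
/-- `M(k)` is stable under translation. [cite: MochizukiAbsTopIII2015, Prop 5.7 (i)(a) p. 137] -/
theorem vadd_mem_compactOpens (x : K) {A : Set K} (hA : A ∈ compactOpens K) :
    x +ᵥ A ∈ compactOpens K :=
  ⟨hA.1.image _, hA.2.1.image (continuous_const_vadd x), (Homeomorph.addLeft x).isOpenMap _ hA.2.2⟩

/-! ## Part (b): `μ_k^log(x·A) = μ_k^log(A) + μ̇_k^log(x)` -/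

/-- `μ_k(x · A) = |x|_k · μ_k(A)` with `|x|_k` Weil's module (Mathlib's `distribHaarChar`), for every
subset `A`. [cite: MochizukiAbsTopIII2015, Prop 5.7 (i)(b) p. 138] -/
theorem localVolume_units_smul (x : Kˣ) (A : Set K) :
    localVolume K (x • A) = (distribHaarChar K x : ℝ≥0) * localVolume K A := by
  rw [localVolume, localVolume, measure_units_smul (localHaar K) x A, ENNReal.toReal_mul]
  rfl

/-- `μ̇_k(x) = |x|_k` (the module of `x`). [cite: MochizukiAbsTopIII2015, Prop 5.7 (i)(b) p. 138] -/
theorem unitVolume_eq_distribHaarChar (x : Kˣ) :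
    unitVolume K x = (distribHaarChar K x : ℝ≥0) := by
  rw [unitVolume, localVolume_units_smul, localVolume_closedBall_one, mul_one]

/-- `μ̇_k(x) > 0`. [cite: MochizukiAbsTopIII2015, Prop 5.7 (i)(b) p. 138] -/
theorem unitVolume_pos (x : Kˣ) : 0 < unitVolume K x := by
  rw [unitVolume_eq_distribHaarChar]
  exact_mod_cast distribHaarChar_pos

omit [IsUltrametricDist K] [ProperSpace K] [MeasurableSpace K] [BorelSpace K] in
/-- `M(k)` is stable under multiplication by `x ∈ k^×`.
[cite: MochizukiAbsTopIII2015, Prop 5.7 (i)(b) p. 138] -/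
theorem units_smul_mem_compactOpens (x : Kˣ) {A : Set K} (hA : A ∈ compactOpens K) :
    x • A ∈ compactOpens K :=
  ⟨hA.1.smul_set, hA.2.1.smul x, hA.2.2.smul x⟩

/-- **Prop 5.7 (i)(b)**: `μ_k^log(x · A) = μ_k^log(A) + μ̇_k^log(x)` for `A ∈ M(k)`, `x ∈ k^×`.
[cite: MochizukiAbsTopIII2015, Prop 5.7 (i)(b) p. 138] -/
theorem localLogVolume_units_smul (x : Kˣ) {A : Set K} (hA : A ∈ compactOpens K) :
    localLogVolume K (x • A) = localLogVolume K A + unitLogVolume K x := by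
  rw [localLogVolume, localLogVolume, unitLogVolume, localVolume_units_smul,
    unitVolume_eq_distribHaarChar, mul_comm,
    Real.log_mul (localVolume_pos hA).ne' (by exact_mod_cast distribHaarChar_pos.ne')]

/-- **Prop 5.7 (i)(b), in particular**: `μ_k^log(x · A) = μ_k^log(A)` for `x ∈ 𝒪_k^×`, i.e. `‖x‖ = 1`
(indeed `μ̇_k(x) = 1`), for every subset `A`. [cite: MochizukiAbsTopIII2015, Prop 5.7 (i)(b) p. 138] -/
theorem localLogVolume_units_smul_of_norm_eq_one (x : Kˣ) (hx : ‖(x : K)‖ = 1) (A : Set K) :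
    localLogVolume K (x • A) = localLogVolume K A := by
  rw [localLogVolume, localLogVolume, localVolume_units_smul,
    distribHaarChar_eq_one_of_norm_eq_one x hx, NNReal.coe_one, one_mul]

/-! ## The formula `μ_k^log(𝔪_k^n) = -f·n·log p` -/

/-- `μ_k(ϖ^n · 𝒪_k) = q^{-n}` where `q = [𝒪 : ϖ𝒪]` (`resIndex ϖ`), for any `ϖ ∈ k^×` with `‖ϖ‖ ≤ 1`
and `n : ℕ`; for a uniformiser `ϖ`, `ϖ^n 𝒪_k = 𝔪_k^n` and `q = p^f` is the cardinality of the residue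
field. [cite: MochizukiAbsTopIII2015, Prop 5.7 (i)(a) p. 137] -/
theorem localVolume_piBall_pow {ϖ : Kˣ} (hϖ : ‖(ϖ : K)‖ ≤ 1) (n : ℕ) :
    localVolume K ((ϖ ^ n : Kˣ) • closedBall (0 : K) 1) = ((resIndex ϖ : ℝ) ^ n)⁻¹ := by
  rw [localVolume_units_smul, localVolume_closedBall_one, mul_one, map_pow, NNReal.coe_pow,
    distribHaarChar_uniformizer_real hϖ, inv_pow]

/-- `μ_k^log(ϖ^n · 𝒪_k) = -n · log q`, `q = [𝒪 : ϖ𝒪]`.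
[cite: MochizukiAbsTopIII2015, Prop 5.7 (i)(a) p. 137] -/
theorem localLogVolume_piBall_pow {ϖ : Kˣ} (hϖ : ‖(ϖ : K)‖ ≤ 1) (n : ℕ) :
    localLogVolume K ((ϖ ^ n : Kˣ) • closedBall (0 : K) 1) = -(n * Real.log (resIndex ϖ)) := by
  rw [localLogVolume, localVolume_piBall_pow hϖ, Real.log_inv, Real.log_pow]

/-- **Prop 5.7 (i)(a), last sentence**: if the residue field of `k` has cardinality `p^f`, i.e.
`[𝒪_k : ϖ𝒪_k] = p^f` for a uniformiser `ϖ`, then `μ_k^log(𝔪_k^n) = -f·n·log p` (`n : ℕ`; the text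
allows `n ∈ ℤ`, the fractional ideals `𝔪_k^n`, `n < 0`, being compact open as well — TODO(general form):
`n : ℤ`). [cite: MochizukiAbsTopIII2015, Prop 5.7 (i)(a) p. 137] -/
theorem localLogVolume_piBall_pow_eq {ϖ : Kˣ} (hϖ : ‖(ϖ : K)‖ ≤ 1) {p f : ℕ}
    (hq : resIndex ϖ = p ^ f) (n : ℕ) :
    localLogVolume K ((ϖ ^ n : Kˣ) • closedBall (0 : K) 1) = -(f * n * Real.log p) := by
  rw [localLogVolume_piBall_pow hϖ, hq, Nat.cast_pow, Real.log_pow]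
  ring

/-! ## Named facts: uniqueness in (a), and the log-compatibility (c) -/

variable (K)

/-- **Prop 5.7 (i)(a), uniqueness** (named fact, not proved here): any map `M(k) → ℝ` that is
additive on disjoint unions, translation invariant and normalised by `𝒪_k ↦ 1` coincides with `μ_k`
on `M(k)`. (Proof in the text: Haar measure; directly: every `A ∈ M(k)` is a finite disjoint union of
cosets of `𝔪_k^n`.) [cite: MochizukiAbsTopIII2015, Prop 5.7 (i)(a) p. 137] -/
def LocalVolumeUnique : Prop :=
  ∀ ν : Set K → ℝ,
    (∀ A ∈ compactOpens K, ∀ B ∈ compactOpens K, Disjoint A B → ν (A ∪ B) = ν A + ν B) →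
    (∀ A ∈ compactOpens K, ∀ x : K, ν (x +ᵥ A) = ν A) →
    ν (closedBall (0 : K) 1) = 1 →
    ∀ A ∈ compactOpens K, ν A = localVolume K A

variable {K}

/-- **Prop 5.7 (i)(c), log-compatibility**, as a predicate on a map `log : k → k` (to be applied to
the `p`-adic logarithm `log_k : 𝒪_k^× → k`, extended by junk values): for every `A ∈ M(k)` contained
in `𝒪_k^× = {‖x‖ = 1}` on which `log` is injective and whose image is again in `M(k)`,
`μ_k^log(A) = μ_k^log(log(A))`. The text proves it for `log_k` by reducing to `A = x + 𝔪_k^n` with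
`n` large, where `log_k` restricts to a bijection onto `log_k(x) + 𝔪_k^n` (p. 139). Named here because
the `p`-adic logarithm of a general local field is not available at the pin (TODO-merge:abc-iut-S1).
[cite: MochizukiAbsTopIII2015, Prop 5.7 (i)(c) p. 138] -/
def LogVolumeCompatible (log : K → K) : Prop :=
  ∀ A ∈ compactOpens K, A ⊆ {x : K | ‖x‖ = 1} → InjOn log A → log '' A ∈ compactOpens K →
    localLogVolume K A = localLogVolume K (log '' A)

/-- The hypothesis on `log_k` that the text's proof of (c) actually uses ("`log_k` determines a
bijection `x + 𝔪_k^n ≅ log_k(x) + 𝔪_k^n`" for all units `x` and all sufficiently large `n`, p. 139),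
as a predicate: there is a radius `r₀ > 0` such that `log` maps every closed ball of radius `r ≤ r₀`
centred at a unit onto the closed ball of the same radius centred at the image.
[cite: MochizukiAbsTopIII2015, Prop 5.7 (i) proof p. 139] -/
def IsIsometricOnSmallBalls (log : K → K) : Prop :=
  ∃ r₀ : ℝ, 0 < r₀ ∧ ∀ x : K, ‖x‖ = 1 → ∀ r : ℝ, 0 < r → r ≤ r₀ →
    log '' closedBall x r = closedBall (log x) r

/-- **Prop 5.7 (i)(c) reduced to its analytic input** (named fact, the combinatorial half of the
text's proof, p. 139): a map that is isometric on small balls around units in the above sense is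
log-volume compatible. [cite: MochizukiAbsTopIII2015, Prop 5.7 (i)(c) p. 138] -/
def LogVolumeCompatibleOfIsometric : Prop :=
  ∀ log : K → K, IsIsometricOnSmallBalls log → LogVolumeCompatible log

/-! ## Appendix (append-only, ref-b PASS-7 ask B3): the `n ∈ ℤ` form of `μ_k^log(𝔪_k^n) = -f·n·log p` -/

/-- `μ_k(ϖ^n · 𝒪_k) = q^{-n}` for ALL `n ∈ ℤ` (`q = [𝒪 : ϖ𝒪]`; for `n < 0` these are the fractional ideals
`𝔪_k^n`, compact open as well), `‖ϖ‖ ≤ 1`. [cite: MochizukiAbsTopIII2015, Prop 5.7 (i)(a) p. 137] -/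
theorem localVolume_piBall_zpow {ϖ : Kˣ} (hϖ : ‖(ϖ : K)‖ ≤ 1) (n : ℤ) :
    localVolume K ((ϖ ^ n : Kˣ) • closedBall (0 : K) 1) = ((resIndex ϖ : ℝ) ^ n)⁻¹ := by
  rw [localVolume_units_smul, localVolume_closedBall_one, mul_one]
  have key : ∀ m : ℕ, ((distribHaarChar K (ϖ ^ m) : ℝ≥0) : ℝ) = ((resIndex ϖ : ℝ) ^ m)⁻¹ := fun m => by
    rw [map_pow, NNReal.coe_pow, distribHaarChar_uniformizer_real hϖ, inv_pow]
  cases n with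
  | ofNat m => simpa only [Int.ofNat_eq_natCast, zpow_natCast] using key m
  | negSucc m =>
    rw [zpow_negSucc, zpow_negSucc, inv_inv]
    have hq : ((resIndex ϖ : ℝ) ^ (m + 1)) ≠ 0 := pow_ne_zero _ (by exact_mod_cast (resIndex_pos ϖ).ne')
    have h1 : distribHaarChar K (ϖ ^ (m + 1))⁻¹ * distribHaarChar K (ϖ ^ (m + 1)) = 1 := by
      rw [← map_mul, inv_mul_cancel, map_one]
    have h1' : ((distribHaarChar K (ϖ ^ (m + 1))⁻¹ : ℝ≥0) : ℝ) * ((resIndex ϖ : ℝ) ^ (m + 1))⁻¹ = 1 := by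
      rw [← key (m + 1)]; exact_mod_cast h1
    calc ((distribHaarChar K (ϖ ^ (m + 1))⁻¹ : ℝ≥0) : ℝ)
        = ((distribHaarChar K (ϖ ^ (m + 1))⁻¹ : ℝ≥0) : ℝ) * ((resIndex ϖ : ℝ) ^ (m + 1))⁻¹ *
            (resIndex ϖ : ℝ) ^ (m + 1) := by rw [mul_assoc, inv_mul_cancel₀ hq, mul_one]
      _ = (resIndex ϖ : ℝ) ^ (m + 1) := by rw [h1', one_mul]

/-- **Prop 5.7 (i)(a), last sentence, general form**: `μ_k^log(𝔪_k^n) = -f·n·log p` for every `n ∈ ℤ`, given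
`[𝒪_k : ϖ𝒪_k] = p^f` (this discharges the `TODO(general form)` of `localLogVolume_piBall_pow_eq`).
[cite: MochizukiAbsTopIII2015, Prop 5.7 (i)(a) p. 137] -/
theorem localLogVolume_piBall_zpow_eq {ϖ : Kˣ} (hϖ : ‖(ϖ : K)‖ ≤ 1) {p f : ℕ}
    (hq : resIndex ϖ = p ^ f) (n : ℤ) :
    localLogVolume K ((ϖ ^ n : Kˣ) • closedBall (0 : K) 1) = -(f * n * Real.log p) := by
  rw [localLogVolume, localVolume_piBall_zpow hϖ, hq, Nat.cast_pow, Real.log_inv, Real.log_zpow,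
    Real.log_pow]
  ring

end Literature.AnabelianGeometry.AbsoluteAnabelian

end
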